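import Mathlib.Analysis.Convex.Deriv
import Mathlib.Analysis.SpecialFunctions.Integrals.Basic
import Mathlib.Analysis.SpecialFunctions.SmoothTransition
import Mathlib.MeasureTheory.Integral.IntervalIntegral.Basic

/-!
# One-sided quadrature rules and the calculus of `u ↦ exp(−c/(1−u²))`
(toolkit for the certified enclosures of the fixed-bump constants `I₀ = ∫φ₀`, `N = ‖φ₀‖₂²`,
`φ₀(u) = expNegInvGlue (1 - u²)`; crux `WeilComb.CombShapePositivity`, item stmt-RiemannHypothesis-11229)

* Generic one-sided rules for `∫_a^b g` from function values and endpoint derivatives only: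
  concave `g`: trapezoid `≤ ∫ ≤` trapezoid `+ (b−a)²/8 (g'(a) − g'(b))` (two endpoint tangents, split at the
  midpoint); convex `g`: the reverse; antitone `g`: `(b−a) g(b) ≤ ∫ ≤ (b−a) g(a)`.
* `F_c(u) = exp(−c/(1−u²))`: first and second derivative in closed form,
  `F_c'' = F_c · 2c (3u⁴ + (2c−2)u² − 1)/(1−u²)⁴`, hence concavity/convexity on sub-intervals of `[0,1)` decided by
  the sign of the quartic.
-/

noncomputable section

-- the sub-problem path RiemannHypothesis/RiemannHypothesis duplicates a namespace (D-0017)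
set_option linter.dupNamespace false

open Real Set MeasureTheory intervalIntegral

namespace Summit.RiemannHypothesis.RiemannHypothesis.Theorems.WeilCombBohrFejer

/-! ## Generic one-sided quadrature rules -/

/-- Integral of an affine function. [folklore] -/
theorem integral_affine_bumpQuad (a b C D : ℝ) :
    ∫ x in a..b, (C + D * x) = (b - a) * C + D * ((b ^ 2 - a ^ 2) / 2) := by
  have hD : IntervalIntegrable (fun x : ℝ => D * x) volume a b :=
    (continuous_const.mul continuous_id).intervalIntegrable _ _
  rw [intervalIntegral.integral_add intervalIntegrable_const hD,
    intervalIntegral.integral_const, intervalIntegral.integral_const_mul, integral_id, smul_eq_mul]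

/-- **Concave, two endpoint tangents.** For `g` concave and continuous on `[a,b]` with derivatives `da`, `db`
at the endpoints: `∫_a^b g ≤ (b−a)(g a + g b)/2 + (b−a)²/8 · (da − db)`. [folklore] -/
theorem integral_le_tangentTrapezoid_of_concaveOn {g : ℝ → ℝ} {a b da db : ℝ} (hab : a < b)
    (hg : ConcaveOn ℝ (Icc a b) g) (hcont : ContinuousOn g (Icc a b))
    (ha : HasDerivAt g da a) (hb : HasDerivAt g db b) :
    ∫ x in a..b, g x ≤ (b - a) * (g a + g b) / 2 + (b - a) ^ 2 / 8 * (da - db) := by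
  have ham : a < (a + b) / 2 := by linarith
  have hmb : (a + b) / 2 < b := by linarith
  have hint : ∀ {p q : ℝ}, a ≤ p → q ≤ b → p ≤ q → IntervalIntegrable g volume p q :=
    fun hp hq hpq => (hcont.mono (Icc_subset_Icc hp hq)).intervalIntegrable_of_Icc hpq
  have haff : ∀ (p q C D : ℝ), IntervalIntegrable (fun x : ℝ => C + D * x) volume p q := fun p q C D =>
    (continuous_const.add (continuous_const.mul continuous_id)).intervalIntegrable _ _
  -- left half: tangent at `a`
  have hL : ∫ x in a..(a + b) / 2, g x ≤ ∫ x in a..(a + b) / 2, ((g a - da * a) + da * x) := by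
    refine intervalIntegral.integral_mono_on_of_le_Ioo ham.le (hint le_rfl hmb.le ham.le) (haff _ _ _ _) ?_
    intro x hx
    have hxI : x ∈ Icc a b := ⟨hx.1.le, (hx.2.trans hmb).le⟩
    have h := hg.slope_le_of_hasDerivAt (left_mem_Icc.2 hab.le) hxI hx.1 ha
    rw [slope_def_field, div_le_iff₀ (by linarith [hx.1])] at h
    linarith
  -- right half: tangent at `b`
  have hR : ∫ x in (a + b) / 2..b, g x ≤ ∫ x in (a + b) / 2..b, ((g b - db * b) + db * x) := by
    refine intervalIntegral.integral_mono_on_of_le_Ioo hmb.le (hint ham.le le_rfl hmb.le) (haff _ _ _ _) ?_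
    intro x hx
    have hxI : x ∈ Icc a b := ⟨(ham.trans hx.1).le, hx.2.le⟩
    have h := hg.le_slope_of_hasDerivAt hxI (right_mem_Icc.2 hab.le) hx.2 hb
    rw [slope_def_field, le_div_iff₀ (by linarith [hx.2])] at h
    linarith
  calc ∫ x in a..b, g x = (∫ x in a..(a + b) / 2, g x) + ∫ x in (a + b) / 2..b, g x :=
        (intervalIntegral.integral_add_adjacent_intervals (hint le_rfl hmb.le ham.le)
          (hint ham.le le_rfl hmb.le)).symm
    _ ≤ (∫ x in a..(a + b) / 2, ((g a - da * a) + da * x)) +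
          ∫ x in (a + b) / 2..b, ((g b - db * b) + db * x) := add_le_add hL hR
    _ = (b - a) * (g a + g b) / 2 + (b - a) ^ 2 / 8 * (da - db) := by
        rw [integral_affine_bumpQuad, integral_affine_bumpQuad]
        ring

/-- **Concave, chord.** For `g` concave and continuous on `[a,b]`: `(b−a)(g a + g b)/2 ≤ ∫_a^b g`. [folklore] -/
theorem trapezoid_le_integral_of_concaveOn {g : ℝ → ℝ} {a b : ℝ} (hab : a < b)
    (hg : ConcaveOn ℝ (Icc a b) g) (hcont : ContinuousOn g (Icc a b)) :
    (b - a) * (g a + g b) / 2 ≤ ∫ x in a..b, g x := by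
  have hba : 0 < b - a := by linarith
  have hchord : ∀ x ∈ Icc a b,
      (g a - (g b - g a) / (b - a) * a) + (g b - g a) / (b - a) * x ≤ g x := by
    intro x hx
    have hw1 : 0 ≤ (b - x) / (b - a) := div_nonneg (by linarith [hx.2]) hba.le
    have hw2 : 0 ≤ (x - a) / (b - a) := div_nonneg (by linarith [hx.1]) hba.le
    have hw : (b - x) / (b - a) + (x - a) / (b - a) = 1 := by
      rw [← add_div, show b - x + (x - a) = b - a by ring, div_self hba.ne']
    have h := hg.2 (left_mem_Icc.2 hab.le) (right_mem_Icc.2 hab.le) hw1 hw2 hw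
    simp only [smul_eq_mul] at h
    have ex : (b - x) / (b - a) * a + (x - a) / (b - a) * b = x := by
      field_simp
      ring
    rw [ex] at h
    have e2 : (b - x) / (b - a) * g a + (x - a) / (b - a) * g b =
        (g a - (g b - g a) / (b - a) * a) + (g b - g a) / (b - a) * x := by
      field_simp
      ring
    linarith
  calc (b - a) * (g a + g b) / 2
        = ∫ x in a..b, ((g a - (g b - g a) / (b - a) * a) + (g b - g a) / (b - a) * x) := by
          rw [integral_affine_bumpQuad]
          field_simp
          ring
    _ ≤ ∫ x in a..b, g x :=
          intervalIntegral.integral_mono_on hab.le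
            ((continuous_const.add (continuous_const.mul continuous_id)).intervalIntegrable _ _)
            (hcont.intervalIntegrable_of_Icc hab.le) hchord

/-- **Convex, two endpoint tangents.** For `g` convex and continuous on `[a,b]` with derivatives `da`, `db` at
the endpoints: `(b−a)(g a + g b)/2 + (b−a)²/8 · (da − db) ≤ ∫_a^b g`. [folklore] -/
theorem tangentTrapezoid_le_integral_of_convexOn {g : ℝ → ℝ} {a b da db : ℝ} (hab : a < b)
    (hg : ConvexOn ℝ (Icc a b) g) (hcont : ContinuousOn g (Icc a b))
    (ha : HasDerivAt g da a) (hb : HasDerivAt g db b) :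
    (b - a) * (g a + g b) / 2 + (b - a) ^ 2 / 8 * (da - db) ≤ ∫ x in a..b, g x := by
  have h := integral_le_tangentTrapezoid_of_concaveOn (g := fun x => -g x) hab hg.neg hcont.neg ha.neg hb.neg
  rw [intervalIntegral.integral_neg] at h
  linarith

/-- **Convex, chord.** For `g` convex and continuous on `[a,b]`: `∫_a^b g ≤ (b−a)(g a + g b)/2`. [folklore] -/
theorem integral_le_trapezoid_of_convexOn {g : ℝ → ℝ} {a b : ℝ} (hab : a < b)
    (hg : ConvexOn ℝ (Icc a b) g) (hcont : ContinuousOn g (Icc a b)) :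
    ∫ x in a..b, g x ≤ (b - a) * (g a + g b) / 2 := by
  have h := trapezoid_le_integral_of_concaveOn (g := fun x => -g x) hab hg.neg hcont.neg
  rw [intervalIntegral.integral_neg] at h
  linarith

/-- **Antitone, crude.** `(b−a) g(b) ≤ ∫_a^b g ≤ (b−a) g(a)` for `g` antitone on `[a,b]`. [folklore] -/
theorem integral_le_of_antitoneOn_bumpQuad {g : ℝ → ℝ} {a b : ℝ} (hab : a ≤ b)
    (hg : AntitoneOn g (Icc a b)) : ∫ x in a..b, g x ≤ (b - a) * g a := by
  have hg' : AntitoneOn g (uIcc a b) := by rwa [uIcc_of_le hab]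
  calc ∫ x in a..b, g x ≤ ∫ _ in a..b, g a :=
        intervalIntegral.integral_mono_on hab hg'.intervalIntegrable intervalIntegrable_const
          fun x hx => hg (left_mem_Icc.2 hab) hx hx.1
    _ = (b - a) * g a := by rw [intervalIntegral.integral_const, smul_eq_mul]

/-- **Antitone, crude (lower).** [folklore] -/
theorem le_integral_of_antitoneOn_bumpQuad {g : ℝ → ℝ} {a b : ℝ} (hab : a ≤ b)
    (hg : AntitoneOn g (Icc a b)) : (b - a) * g b ≤ ∫ x in a..b, g x := by
  have hg' : AntitoneOn g (uIcc a b) := by rwa [uIcc_of_le hab]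
  calc (b - a) * g b = ∫ _ in a..b, g b := by rw [intervalIntegral.integral_const, smul_eq_mul]
    _ ≤ ∫ x in a..b, g x :=
        intervalIntegral.integral_mono_on hab intervalIntegrable_const hg'.intervalIntegrable
          fun x hx => hg hx (right_mem_Icc.2 hab) hx.2

/-! ## The functions `F_c(u) = exp(−c/(1−u²))` -/

/-- `F_c' = F_c · (−2cu/(1−u²)²)` off `u² = 1`. [folklore] -/
theorem hasDerivAt_bumpExp (c : ℝ) {u : ℝ} (hu : 1 - u ^ 2 ≠ 0) :
    HasDerivAt (fun x : ℝ => Real.exp (-c / (1 - x ^ 2)))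
      (Real.exp (-c / (1 - u ^ 2)) * (-(2 * c * u) / (1 - u ^ 2) ^ 2)) u := by
  have h1 : HasDerivAt (fun x : ℝ => 1 - x ^ 2) (-(2 * u)) u := by
    have := (hasDerivAt_pow 2 u).const_sub 1
    refine this.congr_deriv ?_
    norm_num
  have h2 : HasDerivAt (fun x : ℝ => -c / (1 - x ^ 2)) (-(2 * c * u) / (1 - u ^ 2) ^ 2) u := by
    have := (h1.inv hu).const_mul (-c)
    refine HasDerivAt.congr_deriv (this.congr_of_eventuallyEq ?_) ?_
    · exact Filter.Eventually.of_forall fun x => by simp [div_eq_mul_inv]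
    · field_simp
  exact h2.exp

/-- `(F_c')' = F_c · 2c(3u⁴ + (2c−2)u² − 1)/(1−u²)⁴` off `u² = 1`. [folklore] -/
theorem hasDerivAt_bumpExp_deriv (c : ℝ) {u : ℝ} (hu : 1 - u ^ 2 ≠ 0) :
    HasDerivAt (fun x : ℝ => Real.exp (-c / (1 - x ^ 2)) * (-(2 * c * x) / (1 - x ^ 2) ^ 2))
      (Real.exp (-c / (1 - u ^ 2)) *
        (2 * c * (3 * u ^ 4 + (2 * c - 2) * u ^ 2 - 1) / (1 - u ^ 2) ^ 4)) u := by
  have hF := hasDerivAt_bumpExp c hu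
  have hn : HasDerivAt (fun x : ℝ => -(2 * c * x)) (-(2 * c)) u := by
    have := ((hasDerivAt_id u).const_mul (2 * c)).neg
    refine this.congr_deriv ?_
    simp
  have hd : HasDerivAt (fun x : ℝ => (1 - x ^ 2) ^ 2) (-(4 * u * (1 - u ^ 2))) u := by
    have := ((hasDerivAt_pow 2 u).const_sub 1).pow 2
    refine this.congr_deriv ?_
    norm_num
    ring
  have hq := hn.div hd (pow_ne_zero 2 hu)
  refine (hF.mul hq).congr_deriv ?_
  simp only [Pi.div_apply]
  field_simp
  ring

/-- Continuity of `F_c` on `[a,b] ⊆ [0,1)`. [folklore] -/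
theorem continuousOn_bumpExp (c : ℝ) {a b : ℝ} (ha : 0 ≤ a) (hb : b < 1) :
    ContinuousOn (fun x : ℝ => Real.exp (-c / (1 - x ^ 2))) (Icc a b) := by
  intro x hx
  have hx1 : 1 - x ^ 2 ≠ 0 := by nlinarith [hx.1, hx.2]
  exact (hasDerivAt_bumpExp c hx1).continuousAt.continuousWithinAt

/-- **Concavity of `F_c` where the quartic is nonpositive.** [folklore] -/
theorem concaveOn_bumpExp {c a b : ℝ} (hc : 0 ≤ c) (ha : 0 ≤ a) (hb : b < 1)
    (hpoly : ∀ x : ℝ, a < x → x < b → 3 * x ^ 4 + (2 * c - 2) * x ^ 2 - 1 ≤ 0) :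
    ConcaveOn ℝ (Icc a b) (fun x : ℝ => Real.exp (-c / (1 - x ^ 2))) := by
  refine concaveOn_of_hasDerivWithinAt2_nonpos (convex_Icc a b)
    (f' := fun x => Real.exp (-c / (1 - x ^ 2)) * (-(2 * c * x) / (1 - x ^ 2) ^ 2))
    (f'' := fun x => Real.exp (-c / (1 - x ^ 2)) *
        (2 * c * (3 * x ^ 4 + (2 * c - 2) * x ^ 2 - 1) / (1 - x ^ 2) ^ 4))
    (continuousOn_bumpExp c ha hb) ?_ ?_ ?_
  · intro x hx
    rw [interior_Icc] at hx
    have hx1 : 1 - x ^ 2 ≠ 0 := by nlinarith [hx.1, hx.2]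
    exact (hasDerivAt_bumpExp c hx1).hasDerivWithinAt
  · intro x hx
    rw [interior_Icc] at hx
    have hx1 : 1 - x ^ 2 ≠ 0 := by nlinarith [hx.1, hx.2]
    exact (hasDerivAt_bumpExp_deriv c hx1).hasDerivWithinAt
  · intro x hx
    rw [interior_Icc] at hx
    have hx1 : 0 < 1 - x ^ 2 := by nlinarith [hx.1, hx.2]
    have hp := hpoly x hx.1 hx.2
    refine mul_nonpos_of_nonneg_of_nonpos (Real.exp_pos _).le ?_
    exact div_nonpos_of_nonpos_of_nonneg (by nlinarith) (by positivity)

/-- **Convexity of `F_c` where the quartic is nonnegative.** [folklore] -/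
theorem convexOn_bumpExp {c a b : ℝ} (hc : 0 ≤ c) (ha : 0 ≤ a) (hb : b < 1)
    (hpoly : ∀ x : ℝ, a < x → x < b → 0 ≤ 3 * x ^ 4 + (2 * c - 2) * x ^ 2 - 1) :
    ConvexOn ℝ (Icc a b) (fun x : ℝ => Real.exp (-c / (1 - x ^ 2))) := by
  refine convexOn_of_hasDerivWithinAt2_nonneg (convex_Icc a b)
    (f' := fun x => Real.exp (-c / (1 - x ^ 2)) * (-(2 * c * x) / (1 - x ^ 2) ^ 2))
    (f'' := fun x => Real.exp (-c / (1 - x ^ 2)) *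
        (2 * c * (3 * x ^ 4 + (2 * c - 2) * x ^ 2 - 1) / (1 - x ^ 2) ^ 4))
    (continuousOn_bumpExp c ha hb) ?_ ?_ ?_
  · intro x hx
    rw [interior_Icc] at hx
    have hx1 : 1 - x ^ 2 ≠ 0 := by nlinarith [hx.1, hx.2]
    exact (hasDerivAt_bumpExp c hx1).hasDerivWithinAt
  · intro x hx
    rw [interior_Icc] at hx
    have hx1 : 1 - x ^ 2 ≠ 0 := by nlinarith [hx.1, hx.2]
    exact (hasDerivAt_bumpExp_deriv c hx1).hasDerivWithinAt
  · intro x hx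
    rw [interior_Icc] at hx
    have hx1 : 0 < 1 - x ^ 2 := by nlinarith [hx.1, hx.2]
    have hp := hpoly x hx.1 hx.2
    refine mul_nonneg (Real.exp_pos _).le ?_
    exact div_nonneg (by nlinarith) (by positivity)

/-! ## The fixed bump `φ₀(u) = expNegInvGlue (1 − u²)` against `F_1`, `F_2` -/

/-- On `u² < 1`, `φ₀(u) = exp(−1/(1−u²))`. [folklore] -/
theorem shapeBump_eq_bumpExp {u : ℝ} (hu : u ^ 2 < 1) :
    expNegInvGlue (1 - u ^ 2) = Real.exp (-1 / (1 - u ^ 2)) := by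
  have h : 0 < 1 - u ^ 2 := by linarith
  rw [expNegInvGlue, if_neg (not_le.2 h), neg_div, one_div]

/-- On `u² < 1`, `φ₀(u)² = exp(−2/(1−u²))`. [folklore] -/
theorem shapeBump_sq_eq_bumpExp {u : ℝ} (hu : u ^ 2 < 1) :
    expNegInvGlue (1 - u ^ 2) ^ 2 = Real.exp (-2 / (1 - u ^ 2)) := by
  rw [shapeBump_eq_bumpExp hu, sq, ← Real.exp_add]
  congr 1
  ring

/-- `φ₀` is antitone on `[0, ∞)`. [folklore] -/
theorem shapeBump_antitoneOn : AntitoneOn (fun u : ℝ => expNegInvGlue (1 - u ^ 2)) (Ici 0) := by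
  intro x hx y _ hxy
  exact expNegInvGlue.monotone (by nlinarith [mem_Ici.1 hx])

/-- `φ₀²` is antitone on `[0, ∞)`. [folklore] -/
theorem shapeBump_sq_antitoneOn : AntitoneOn (fun u : ℝ => expNegInvGlue (1 - u ^ 2) ^ 2) (Ici 0) := by
  intro x hx y hy hxy
  exact pow_le_pow_left₀ (expNegInvGlue.nonneg _) (shapeBump_antitoneOn hx hy hxy) 2

/-- `φ₀` is continuous (local copy; the tree's `continuous_shapeBump` lives in `…BumpCellBounds`). [folklore] -/
private theorem continuous_shapeBump_aux : Continuous fun u : ℝ => expNegInvGlue (1 - u ^ 2) :=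
  (expNegInvGlue.contDiff (n := 0)).continuous.comp (continuous_const.sub (continuous_pow 2))

/-- `∫_ℝ φ₀ = 2 ∫_0^1 φ₀` (support `[−1,1]`, evenness). [folklore] -/
theorem integral_shapeBump_eq_twice_Icc01 :
    ∫ u : ℝ, expNegInvGlue (1 - u ^ 2) = 2 * ∫ u in (0 : ℝ)..1, expNegInvGlue (1 - u ^ 2) := by
  have hsupp : Function.support (fun u : ℝ => expNegInvGlue (1 - u ^ 2)) ⊆ Ioc (-1) 1 := by
    intro u hu
    rw [Function.mem_support] at hu
    by_contra hc
    apply hu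
    apply expNegInvGlue.zero_of_nonpos
    simp only [mem_Ioc, not_and_or, not_lt, not_le] at hc
    rcases hc with h | h <;> nlinarith
  rw [← intervalIntegral.integral_eq_integral_of_support_subset hsupp]
  have hi : ∀ a b : ℝ, IntervalIntegrable (fun u : ℝ => expNegInvGlue (1 - u ^ 2)) volume a b :=
    fun a b => continuous_shapeBump_aux.intervalIntegrable a b
  rw [← intervalIntegral.integral_add_adjacent_intervals (hi (-1) 0) (hi 0 1)]
  have hneg : ∫ u in (-1 : ℝ)..0, expNegInvGlue (1 - u ^ 2) = ∫ u in (0 : ℝ)..1, expNegInvGlue (1 - u ^ 2) := by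
    have h := intervalIntegral.integral_comp_neg (a := (-1 : ℝ)) (b := 0)
      (f := fun u : ℝ => expNegInvGlue (1 - u ^ 2))
    simp only [neg_sq, neg_neg, neg_zero] at h
    exact h
  rw [hneg]
  ring

/-- `∫_ℝ φ₀² = 2 ∫_0^1 φ₀²`. [folklore] -/
theorem integral_shapeBump_sq_eq_twice_Icc01 :
    ∫ u : ℝ, expNegInvGlue (1 - u ^ 2) ^ 2 = 2 * ∫ u in (0 : ℝ)..1, expNegInvGlue (1 - u ^ 2) ^ 2 := by
  have hsupp : Function.support (fun u : ℝ => expNegInvGlue (1 - u ^ 2) ^ 2) ⊆ Ioc (-1) 1 := by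
    intro u hu
    rw [Function.mem_support] at hu
    by_contra hc
    apply hu
    rw [expNegInvGlue.zero_of_nonpos, zero_pow two_ne_zero]
    simp only [mem_Ioc, not_and_or, not_lt, not_le] at hc
    rcases hc with h | h <;> nlinarith
  rw [← intervalIntegral.integral_eq_integral_of_support_subset hsupp]
  have hi : ∀ a b : ℝ, IntervalIntegrable (fun u : ℝ => expNegInvGlue (1 - u ^ 2) ^ 2) volume a b :=
    fun a b => (continuous_shapeBump_aux.pow 2).intervalIntegrable a b
  rw [← intervalIntegral.integral_add_adjacent_intervals (hi (-1) 0) (hi 0 1)]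
  have hneg : ∫ u in (-1 : ℝ)..0, expNegInvGlue (1 - u ^ 2) ^ 2 =
      ∫ u in (0 : ℝ)..1, expNegInvGlue (1 - u ^ 2) ^ 2 := by
    have h := intervalIntegral.integral_comp_neg (a := (-1 : ℝ)) (b := 0)
      (f := fun u : ℝ => expNegInvGlue (1 - u ^ 2) ^ 2)
    simp only [neg_sq, neg_neg, neg_zero] at h
    exact h
  rw [hneg]
  ring

/-! ## Regions of concavity / convexity and the integrand on `[0, 19/20]` -/

/-- `[a,b] ⊆ [0,∞)` for `0 ≤ a`. [folklore] -/
theorem Icc_subset_Ici_bumpQuad {a b : ℝ} (ha : 0 ≤ a) : Icc a b ⊆ Ici 0 := fun _ hx => mem_Ici.2 (ha.trans hx.1)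

/-- On `[a,b] ⊆ [0,1)`: `∫_a^b φ₀ = ∫_a^b exp(−1/(1−u²))`. [folklore] -/
theorem integral_shapeBump_eq_bumpExp {a b : ℝ} (ha : 0 ≤ a) (hab : a ≤ b) (hb : b < 1) :
    ∫ x in a..b, expNegInvGlue (1 - x ^ 2) = ∫ x in a..b, Real.exp (-1 / (1 - x ^ 2)) := by
  refine intervalIntegral.integral_congr fun x hx => ?_
  rw [uIcc_of_le hab] at hx
  exact shapeBump_eq_bumpExp (by nlinarith [hx.1, hx.2])

/-- On `[a,b] ⊆ [0,1)`: `∫_a^b φ₀² = ∫_a^b exp(−2/(1−u²))`. [folklore] -/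
theorem integral_shapeBump_sq_eq_bumpExp {a b : ℝ} (ha : 0 ≤ a) (hab : a ≤ b) (hb : b < 1) :
    ∫ x in a..b, expNegInvGlue (1 - x ^ 2) ^ 2 = ∫ x in a..b, Real.exp (-2 / (1 - x ^ 2)) := by
  refine intervalIntegral.integral_congr fun x hx => ?_
  rw [uIcc_of_le hab] at hx
  exact shapeBump_sq_eq_bumpExp (by nlinarith [hx.1, hx.2])

/-- `F₁` is concave on `[0, 3/4]` (`3u⁴ ≤ 243/256 < 1`). [folklore] -/
theorem concaveOn_bumpExp_one : ConcaveOn ℝ (Icc (0 : ℝ) (3 / 4)) (fun x : ℝ => Real.exp (-1 / (1 - x ^ 2))) := by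
  refine concaveOn_bumpExp (c := 1) (by norm_num) le_rfl (by norm_num) fun x h0 h1 => ?_
  have h2 : x ^ 2 ≤ 9 / 16 := by nlinarith
  have h4 : x ^ 4 ≤ 9 / 16 * x ^ 2 := by
    have e : x ^ 4 = x ^ 2 * x ^ 2 := by ring
    rw [e]
    exact mul_le_mul_of_nonneg_right h2 (sq_nonneg x)
  nlinarith

/-- `F₁` is convex on `[19/25, 19/20]` (`3u⁴ ≥ 3(361/625)² > 1`). [folklore] -/
theorem convexOn_bumpExp_one : ConvexOn ℝ (Icc (19 / 25 : ℝ) (19 / 20)) (fun x : ℝ => Real.exp (-1 / (1 - x ^ 2))) := by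
  refine convexOn_bumpExp (c := 1) (by norm_num) (by norm_num) (by norm_num) fun x h0 h1 => ?_
  have h2 : 361 / 625 ≤ x ^ 2 := by nlinarith
  have h4 : 361 / 625 * x ^ 2 ≤ x ^ 4 := by
    have e : x ^ 4 = x ^ 2 * x ^ 2 := by ring
    rw [e]
    exact mul_le_mul_of_nonneg_right h2 (sq_nonneg x)
  nlinarith

/-- `F₂` is concave on `[0, 9/16]`. [folklore] -/
theorem concaveOn_bumpExp_two : ConcaveOn ℝ (Icc (0 : ℝ) (9 / 16)) (fun x : ℝ => Real.exp (-2 / (1 - x ^ 2))) := by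
  refine concaveOn_bumpExp (c := 2) (by norm_num) le_rfl (by norm_num) fun x h0 h1 => ?_
  have h2 : x ^ 2 ≤ 81 / 256 := by nlinarith
  have h4 : x ^ 4 ≤ 81 / 256 * x ^ 2 := by
    have e : x ^ 4 = x ^ 2 * x ^ 2 := by ring
    rw [e]
    exact mul_le_mul_of_nonneg_right h2 (sq_nonneg x)
  nlinarith

/-- `F₂` is convex on `[289/500, 19/20]`. [folklore] -/
theorem convexOn_bumpExp_two : ConvexOn ℝ (Icc (289 / 500 : ℝ) (19 / 20)) (fun x : ℝ => Real.exp (-2 / (1 - x ^ 2))) := by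
  refine convexOn_bumpExp (c := 2) (by norm_num) (by norm_num) (by norm_num) fun x h0 h1 => ?_
  have h2 : 83521 / 250000 ≤ x ^ 2 := by nlinarith
  have h4 : 83521 / 250000 * x ^ 2 ≤ x ^ 4 := by
    have e : x ^ 4 = x ^ 2 * x ^ 2 := by ring
    rw [e]
    exact mul_le_mul_of_nonneg_right h2 (sq_nonneg x)
  nlinarith

end Summit.RiemannHypothesis.RiemannHypothesis.Theorems.WeilCombBohrFejer

end
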